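import Literature.MathematicalPhysics.QuantumFieldTheory.Balaban1983to89.Node00.BetaOfRecord

/-!
# BalabanUVNodes ∕ node N22 = NE9 — THE (α)→(β′) LEG IN KERNEL CURRENCY, MODULE J27 (SCHEMA): THE POLARIZATION KERNEL (1.20) OF A LOCALIZED SUM (1.7) IS CONTROLLED TERM BY TERM —
# additivity of the second Fréchet derivative over the (1.7) terms, vanishing of a term's kernel off its own sites, and the resulting TWO-POINT SUM bound for the history difference of the
# kernel (`Σ_{X ∋ x, y} a(X)`), lifted to def-B's scalar trace `polScalar` of the exponential chart — the estimate-free half of «NE9 of the (1.21) window from NE9 of the (1.7) terms»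

Cell `pub-ymgap`, HUMAN RULING D-0062 (Track A), R134 ACCELERATION re-seat `pub-ymgap-dag-n22-c` (strategy s1), generation 11, file J27.  THEOREMS ONLY; imports def-B's
`Node00/BetaOfRecord` (`polScalar`, `polWindow`, through it `B12PolarizationTensor120.polTensor ∕ polComp ∕ expChart`) BY NAME.  `--supports` K3⁷ `SpineGivenEndpointR13SepCoPH`
(stmt-QuantumFields-20544) as a helper.

WHY (plan g81 Q1 RULING (β), bus l.26065, 2026-08-28): node U3's object of record is W1-19's `U3OfKernels.objectsOfRecord₁₃` — the LIMITING (1.21) kernels — so N22 is owed in KERNEL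
currency; «the walk (α)→(β′)→(β) = n22 lane».  The (β′)→(β) passage is dag-n22-w3's `YMDAG.N22.AtKernels.ne9_EA_of_windowed` (p593053: windowed finite-volume joint history-Lipschitz
bounds UNIFORM in the approximation index `K` + def-B's `PolLimitExists` ⇒ NE9 of the limiting kernels), and W1-20 `Node00/LocalizedSum17` makes the kernels of record the kernels of the
W1 reading's (1.7) localized sum under `Localizes17`.  What the n22 lane owes is the windowed input FROM THE TERMS: [I] (1.7) p. 261 «E^{(j)}(g_{j−1}, U_j) = Σ_{X∈D_j} E^{(j)}(X, g_{j−1},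
U_j)», (1.20) p. 264 «Π^{ab}_{j+1,μν}(g_j, x, x′) = (δ²∕(δB^a_μ(x)δB^b_ν(x′)) 𝐄^{(j+1)})(g_j, 0)», p. 264 «uniformly bounded … together with all derivatives … This limit exists by the
localized representation (1.7)».  The mechanism has an ESTIMATE-FREE half (this file) and an ESTIMATE (module J28, the per-term Cauchy bound on the analyticity polydisc): (i) the
second Fréchet derivative of a finite sum of twice-differentiable functionals is the sum of the second derivatives (`polTensor_finset_sum`); (ii) a term that reads the probe field only on
its own sites has vanishing kernel at every pair of sites not both its own — so under a PER-TERM bound `|Π_X(g) − Π_X(g′)| ≤ a(X)` supported on `x, y ∈ supp X` (module J28's output: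
`a(X) = 4r⁻² e^{−κ d(X)} Σ_i Λ_i |g_i − g′_i|` from locality + Cauchy + term-level NE9), the kernel of the sum obeys `|Π(g) − Π(g′)| ≤ Σ_{X ∈ s, x,y ∈ supp X} a(X)`
(`abs_polTensor_sum_sub_le_twoPointSum`); (iii) the same for def-B's SCALAR kernel `polScalar` of the exponential chart, the normalised colour trace (`abs_polScalar_sum_sub_le_twoPointSum`),
and under a two-point tree-sum bound `Σ_{X ∋ x,y} a(X) ≤ A·e^{−κ′ d(x,y)}` the window shape `|Π(g)(x,y) − Π(g′)(x,y)| ≤ A e^{−κ′ d(x,y)}` (`abs_polScalar_sum_sub_le_of_twoPointSum_le`) — at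
the sites `(z, 0)` of the `K`-th torus this IS dag-n22-w3's hypothesis `hK` for that `K` (`abs_polWindow_sum_sub_le_of_twoPointSum_le`).  The value twin (the kernel ITSELF bounded by
`Σ_{X ∋ x,y} b(X)`, for (D4)'s (5.10) decay — dag-n27-w1's windowed ⇒ `KernelDecay` file consumes it) is `abs_polScalar_sum_le_twoPointSum`.

WHAT.  §1 (generic `𝕜`, any normed `V`, `F`): `polTensor_finset_sum` (additivity of (1.20) in the functional over a `Finset` of terms, each `ContDiffAt 𝕜 2` at `0`), `polTensor_sub`
(difference of two functionals).  §2 (real scalars `F = ℝ`): `abs_polTensor_sum_sub_le_twoPointSum`, `abs_polTensor_sum_le_twoPointSum`.  §3 (def-B's `polScalar` ∕ `polWindow` of the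
exponential chart, `𝔄`-valued configurations): `expChart_finset_sum`, `polScalar_finset_sum`, ★ `abs_polScalar_sum_sub_le_twoPointSum`, `abs_polScalar_sum_le_twoPointSum`,
★ `abs_polScalar_sum_sub_le_of_twoPointSum_le`, ★ `abs_polWindow_sum_sub_le_of_twoPointSum_le`.

HONEST FRAMING — what this is NOT.  Count-neutral calculus bookkeeping (linearity of `fderiv`, the triangle inequality); NO estimate of Bałaban's is proved or asserted — the per-term
bounds `a(X)` (locality + Cauchy + term-level NE9, module J28) and the two-point tree sum are DISPLAYED hypotheses; nothing of the (1.7) terms of record is constructed (NODE A ∕ N10 ∕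
def-W1's `Localizes17OfRecord₁₃`); N22 NOT discharged (typed 28∕28 · discharged 5∕27 UNCHANGED); NE9 NOT IN PRINT for d = 4; one finite four-torus programme at fixed ε — NOT infinite
volume, NOT OS on ℝ⁴, NOT a mass gap, NOT Clay.  0 `sorry`, 0 `def`, standard axioms.

References (TYPES only): [I] = [Balaban1987RG1] (1.7) p. 261, (1.18) p. 263, (1.20)–(1.21) p. 264, §5 p. 298.
-/

noncomputable section

namespace YMDAG.N22.WindowOfLocalTerms

open Filter
open scoped BigOperators Topology
open Literature.MathematicalPhysics.QuantumFieldTheory.Balaban1983to89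
open Literature.MathematicalPhysics.QuantumFieldTheory.Balaban1983to89.B12PolarizationTensor120 (polTensor polComp expChart)
open Literature.MathematicalPhysics.QuantumFieldTheory.Balaban1983to89.Node00 (polScalar polWindow siteOfInt)

/-! ## §1 Additivity of the polarization tensor (1.20) in the functional over the (1.7) terms -/

section Additive

variable (𝕜 : Type*) [NontriviallyNormedField 𝕜] {Λ T V F : Type*} [Fintype Λ] [Fintype T] [DecidableEq Λ] [DecidableEq T]
  [NormedAddCommGroup V] [NormedSpace 𝕜 V] [NormedAddCommGroup F] [NormedSpace 𝕜 F] {𝒳 : Type*}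

/-- **(1.20) IS ADDITIVE OVER THE (1.7) TERMS**: for a finite family of functionals of the probe field, each twice continuously differentiable at `0`, the polarization tensor of the
sum `Σ_X 𝓔_X` is the sum of the polarization tensors (the second Fréchet derivative of a finite sum, near `0` and at `0`). [cite: Balaban1987RG1, (1.7) p.261 and (1.20) p.264] -/
theorem polTensor_finset_sum (s : Finset 𝒳) (𝓔 : 𝒳 → (Λ → T → V) → F) (h𝓔 : ∀ X ∈ s, ContDiffAt 𝕜 2 (𝓔 X) 0)
    (μ : Λ) (x : T) (v : V) (ν : Λ) (y : T) (w : V) :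
    polTensor 𝕜 (fun B => ∑ X ∈ s, 𝓔 X B) μ x v ν y w = ∑ X ∈ s, polTensor 𝕜 (𝓔 X) μ x v ν y w := by
  simp only [polTensor]
  -- near `0` every term is differentiable, so the first derivative of the sum is the sum of the first derivatives there
  have hev : ∀ X ∈ s, ∀ᶠ B in 𝓝 (0 : Λ → T → V), DifferentiableAt 𝕜 (𝓔 X) B := fun X hX =>
    ((h𝓔 X hX).eventually (by simp)).mono fun B hB => hB.differentiableAt (by simp)
  have hall : ∀ᶠ B in 𝓝 (0 : Λ → T → V), ∀ X ∈ s, DifferentiableAt 𝕜 (𝓔 X) B := (s.eventually_all).2 hev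
  have h1 : fderiv 𝕜 (fun B => ∑ X ∈ s, 𝓔 X B) =ᶠ[𝓝 0] ∑ X ∈ s, fderiv 𝕜 (𝓔 X) :=
    hall.mono fun B hB => by rw [fderiv_fun_sum hB, Finset.sum_apply]
  rw [h1.fderiv_eq]
  have h2 : ∀ X ∈ s, DifferentiableAt 𝕜 (fderiv 𝕜 (𝓔 X)) 0 := fun X hX =>
    ((h𝓔 X hX).fderiv_right (m := 1) le_rfl).differentiableAt one_ne_zero
  rw [fderiv_sum h2, _root_.sum_apply, _root_.sum_apply]

/-- (1.20) of a DIFFERENCE of two twice continuously differentiable functionals (the kernel at two coupling histories). [cite: Balaban1987RG1, (1.20) p.264 and §5 p.298] -/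
theorem polTensor_sub (𝓔 𝓔' : (Λ → T → V) → F) (h : ContDiffAt 𝕜 2 𝓔 0) (h' : ContDiffAt 𝕜 2 𝓔' 0) (μ : Λ) (x : T) (v : V) (ν : Λ) (y : T) (w : V) :
    polTensor 𝕜 (fun B => 𝓔 B - 𝓔' B) μ x v ν y w = polTensor 𝕜 𝓔 μ x v ν y w - polTensor 𝕜 𝓔' μ x v ν y w := by
  simp only [polTensor]
  have hev : ∀ᶠ B in 𝓝 (0 : Λ → T → V), DifferentiableAt 𝕜 𝓔 B ∧ DifferentiableAt 𝕜 𝓔' B :=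
    (((h.eventually (by simp)).mono fun B hB => hB.differentiableAt (by simp)).and
      ((h'.eventually (by simp)).mono fun B hB => hB.differentiableAt (by simp)))
  have h1 : fderiv 𝕜 (fun B => 𝓔 B - 𝓔' B) =ᶠ[𝓝 0] fderiv 𝕜 𝓔 - fderiv 𝕜 𝓔' :=
    hev.mono fun B hB => by rw [Pi.sub_apply]; exact fderiv_fun_sub hB.1 hB.2
  rw [h1.fderiv_eq, fderiv_sub ((h.fderiv_right (m := 1) le_rfl).differentiableAt one_ne_zero)
    ((h'.fderiv_right (m := 1) le_rfl).differentiableAt one_ne_zero), _root_.sub_apply, _root_.sub_apply]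

end Additive

/-! ## §2 Real scalars: the two-point sum bound for the history difference of the kernel of a localized sum, and its value twin -/

section TwoPoint

variable {Λ T V : Type*} [Fintype Λ] [Fintype T] [DecidableEq Λ] [DecidableEq T] [NormedAddCommGroup V] [NormedSpace ℝ V] {𝒳 : Type*}

/-- **THE TWO-POINT SUM BOUND FOR THE HISTORY DIFFERENCE OF (1.20) OF A LOCALIZED SUM**: if the terms at the two histories are twice continuously differentiable at `0` and each term's
kernel DIFFERENCE at the pair of sites `(x, y)` is at most `a(X)` when both sites are the term's and vanishes otherwise (module J28: locality + Cauchy + term-level NE9), then the kernel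
of the sum differs by at most `Σ_{X ∈ s, x ∈ supp X, y ∈ supp X} a(X)`. [cite: Balaban1987RG1, (1.7) p.261, (1.18) p.263 and (1.20) p.264] -/
theorem abs_polTensor_sum_sub_le_twoPointSum (s : Finset 𝒳) (𝓔 𝓔' : 𝒳 → (Λ → T → V) → ℝ) (h𝓔 : ∀ X ∈ s, ContDiffAt ℝ 2 (𝓔 X) 0) (h𝓔' : ∀ X ∈ s, ContDiffAt ℝ 2 (𝓔' X) 0)
    (supp : 𝒳 → Set T) [∀ X, DecidablePred (· ∈ supp X)] (a : 𝒳 → ℝ) (μ : Λ) (x : T) (v : V) (ν : Λ) (y : T) (w : V)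
    (hterm : ∀ X ∈ s, |polTensor ℝ (𝓔 X) μ x v ν y w - polTensor ℝ (𝓔' X) μ x v ν y w| ≤ if x ∈ supp X ∧ y ∈ supp X then a X else 0) :
    |polTensor ℝ (fun B => ∑ X ∈ s, 𝓔 X B) μ x v ν y w - polTensor ℝ (fun B => ∑ X ∈ s, 𝓔' X B) μ x v ν y w| ≤
      ∑ X ∈ s.filter (fun X => x ∈ supp X ∧ y ∈ supp X), a X := by
  rw [polTensor_finset_sum ℝ s 𝓔 h𝓔, polTensor_finset_sum ℝ s 𝓔' h𝓔', ← Finset.sum_sub_distrib, Finset.sum_filter]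
  exact (Finset.abs_sum_le_sum_abs _ _).trans (Finset.sum_le_sum hterm)

/-- **The VALUE twin** (for (D4)'s (5.10) decay of the kernel itself): if each term's kernel at `(x, y)` is at most `b(X)` when both sites are the term's and vanishes otherwise, the kernel of
the sum is at most `Σ_{X ∈ s, x,y ∈ supp X} b(X)`. [cite: Balaban1987RG1, (1.7) p.261, (1.18) p.263 and (1.20) p.264] -/
theorem abs_polTensor_sum_le_twoPointSum (s : Finset 𝒳) (𝓔 : 𝒳 → (Λ → T → V) → ℝ) (h𝓔 : ∀ X ∈ s, ContDiffAt ℝ 2 (𝓔 X) 0)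
    (supp : 𝒳 → Set T) [∀ X, DecidablePred (· ∈ supp X)] (b : 𝒳 → ℝ) (μ : Λ) (x : T) (v : V) (ν : Λ) (y : T) (w : V)
    (hterm : ∀ X ∈ s, |polTensor ℝ (𝓔 X) μ x v ν y w| ≤ if x ∈ supp X ∧ y ∈ supp X then b X else 0) :
    |polTensor ℝ (fun B => ∑ X ∈ s, 𝓔 X B) μ x v ν y w| ≤ ∑ X ∈ s.filter (fun X => x ∈ supp X ∧ y ∈ supp X), b X := by
  rw [polTensor_finset_sum ℝ s 𝓔 h𝓔, Finset.sum_filter]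
  exact (Finset.abs_sum_le_sum_abs _ _).trans (Finset.sum_le_sum hterm)

end TwoPoint

/-! ## §3 def-B's scalar kernel of the exponential chart: the same bounds for `polScalar`, and the window shape under a two-point tree sum -/

section Scalar

variable {𝔄 : Type*} [NormedRing 𝔄] [NormedAlgebra ℝ 𝔄] {V : Type*} [NormedAddCommGroup V] [NormedSpace ℝ V] {ι : Type*} [Fintype ι]
  {Λ T : Type*} [Fintype Λ] [Fintype T] [DecidableEq Λ] [DecidableEq T] {𝒳 : Type*}

omit [Fintype Λ] [Fintype T] [DecidableEq Λ] [DecidableEq T] in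
/-- The exponential chart of a finite sum of functionals is the finite sum of the charts (pointwise; `expChart ℰ ρ B = ℰ(exp ρB)`). [cite: Balaban1987RG1, p.264 (before (1.20))] -/
theorem expChart_finset_sum (s : Finset 𝒳) (ℰ : 𝒳 → (Λ → T → 𝔄) → ℝ) (ρ : V →L[ℝ] 𝔄) :
    expChart (fun U => ∑ X ∈ s, ℰ X U) ρ = fun B => ∑ X ∈ s, expChart (ℰ X) ρ B := by
  funext B; simp only [B12PolarizationTensor120.expChart_apply]

/-- **ADDITIVITY OF def-B's SCALAR KERNEL over the (1.7) terms** (the normalised colour trace of `polComp` of the exponential chart): each chart twice continuously differentiable at `0`.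
[cite: Balaban1987RG1, (1.7) p.261 and (1.20)-(1.21) p.264] -/
theorem polScalar_finset_sum (s : Finset 𝒳) (ℰ : 𝒳 → (Λ → T → 𝔄) → ℝ) (ρ : V →L[ℝ] 𝔄) (bV : Module.Basis ι ℝ V)
    (hℰ : ∀ X ∈ s, ContDiffAt ℝ 2 (expChart (ℰ X) ρ) 0) (μ : Λ) (x : T) (ν : Λ) (y : T) :
    polScalar (fun U => ∑ X ∈ s, ℰ X U) ρ bV μ x ν y = ∑ X ∈ s, polScalar (ℰ X) ρ bV μ x ν y := by
  simp only [polScalar, polComp, expChart_finset_sum, polTensor_finset_sum ℝ s _ hℰ, Finset.mul_sum]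
  rw [Finset.sum_comm]

/-- **★ THE TWO-POINT SUM BOUND FOR THE HISTORY DIFFERENCE OF def-B's SCALAR KERNEL OF A LOCALIZED SUM**: if, at the two histories, every term's chart is twice continuously differentiable at
`0` and every term's COLOUR-DIAGONAL kernel difference at `(x, y)` is `≤ a(X)` when both sites are the term's and `0` otherwise (`a ≥ 0` on `s`), then
`|Π(g)(x,y) − Π(g′)(x,y)| ≤ Σ_{X ∈ s, x,y ∈ supp X} a(X)` (the colour trace is an average). [cite: Balaban1987RG1, (1.7) p.261, (1.18) p.263 and (1.20)-(1.21) p.264] -/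
theorem abs_polScalar_sum_sub_le_twoPointSum (s : Finset 𝒳) (ℰ ℰ' : 𝒳 → (Λ → T → 𝔄) → ℝ) (ρ : V →L[ℝ] 𝔄) (bV : Module.Basis ι ℝ V)
    (hℰ : ∀ X ∈ s, ContDiffAt ℝ 2 (expChart (ℰ X) ρ) 0) (hℰ' : ∀ X ∈ s, ContDiffAt ℝ 2 (expChart (ℰ' X) ρ) 0)
    (supp : 𝒳 → Set T) [∀ X, DecidablePred (· ∈ supp X)] (a : 𝒳 → ℝ) (ha : ∀ X ∈ s, 0 ≤ a X) (μ : Λ) (x : T) (ν : Λ) (y : T)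
    (hterm : ∀ X ∈ s, ∀ c : ι, |polComp ℝ (expChart (ℰ X) ρ) bV μ x c ν y c - polComp ℝ (expChart (ℰ' X) ρ) bV μ x c ν y c| ≤
      if x ∈ supp X ∧ y ∈ supp X then a X else 0) :
    |polScalar (fun U => ∑ X ∈ s, ℰ X U) ρ bV μ x ν y - polScalar (fun U => ∑ X ∈ s, ℰ' X U) ρ bV μ x ν y| ≤
      ∑ X ∈ s.filter (fun X => x ∈ supp X ∧ y ∈ supp X), a X := by
  classical
  set S : ℝ := ∑ X ∈ s.filter (fun X => x ∈ supp X ∧ y ∈ supp X), a X with hS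
  have hS0 : 0 ≤ S := Finset.sum_nonneg fun X hX => ha X (Finset.mem_filter.1 hX).1
  -- per colour direction, the §2 bound for the component `polComp … c … c`
  have hc : ∀ c : ι, |polComp ℝ (expChart (fun U => ∑ X ∈ s, ℰ X U) ρ) bV μ x c ν y c -
      polComp ℝ (expChart (fun U => ∑ X ∈ s, ℰ' X U) ρ) bV μ x c ν y c| ≤ S := by
    intro c
    simp only [polComp, expChart_finset_sum]
    exact abs_polTensor_sum_sub_le_twoPointSum s _ _ hℰ hℰ' supp a μ x (bV c) ν y (bV c) (fun X hX => hterm X hX c)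
  simp only [polScalar, ← mul_sub, ← Finset.sum_sub_distrib, abs_mul, abs_inv, Nat.abs_cast]
  by_cases hι : Fintype.card ι = 0
  · rw [hι]; simp [hS0]
  · have hpos : (0 : ℝ) < Fintype.card ι := Nat.cast_pos.2 (Nat.pos_of_ne_zero hι)
    calc (Fintype.card ι : ℝ)⁻¹ * |∑ c, (polComp ℝ (expChart (fun U => ∑ X ∈ s, ℰ X U) ρ) bV μ x c ν y c -
          polComp ℝ (expChart (fun U => ∑ X ∈ s, ℰ' X U) ρ) bV μ x c ν y c)|
        ≤ (Fintype.card ι : ℝ)⁻¹ * ∑ c : ι, S :=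
          mul_le_mul_of_nonneg_left ((Finset.abs_sum_le_sum_abs _ _).trans (Finset.sum_le_sum fun c _ => hc c)) (inv_nonneg.2 hpos.le)
      _ = S := by rw [Finset.sum_const, Finset.card_univ, nsmul_eq_mul, ← mul_assoc, inv_mul_cancel₀ hpos.ne', one_mul]

/-- The VALUE twin for def-B's scalar kernel: `|Π(g)(x,y)| ≤ Σ_{X ∈ s, x,y ∈ supp X} b(X)` under per-term colour-diagonal bounds supported on the term's sites (`b ≥ 0` on `s`).
[cite: Balaban1987RG1, (1.7) p.261, (1.18) p.263 and (1.20)-(1.21) p.264] -/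
theorem abs_polScalar_sum_le_twoPointSum (s : Finset 𝒳) (ℰ : 𝒳 → (Λ → T → 𝔄) → ℝ) (ρ : V →L[ℝ] 𝔄) (bV : Module.Basis ι ℝ V)
    (hℰ : ∀ X ∈ s, ContDiffAt ℝ 2 (expChart (ℰ X) ρ) 0)
    (supp : 𝒳 → Set T) [∀ X, DecidablePred (· ∈ supp X)] (b : 𝒳 → ℝ) (hb : ∀ X ∈ s, 0 ≤ b X) (μ : Λ) (x : T) (ν : Λ) (y : T)
    (hterm : ∀ X ∈ s, ∀ c : ι, |polComp ℝ (expChart (ℰ X) ρ) bV μ x c ν y c| ≤ if x ∈ supp X ∧ y ∈ supp X then b X else 0) :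
    |polScalar (fun U => ∑ X ∈ s, ℰ X U) ρ bV μ x ν y| ≤ ∑ X ∈ s.filter (fun X => x ∈ supp X ∧ y ∈ supp X), b X := by
  classical
  set S : ℝ := ∑ X ∈ s.filter (fun X => x ∈ supp X ∧ y ∈ supp X), b X with hS
  have hS0 : 0 ≤ S := Finset.sum_nonneg fun X hX => hb X (Finset.mem_filter.1 hX).1
  have hc : ∀ c : ι, |polComp ℝ (expChart (fun U => ∑ X ∈ s, ℰ X U) ρ) bV μ x c ν y c| ≤ S := by
    intro c
    simp only [polComp, expChart_finset_sum]
    exact abs_polTensor_sum_le_twoPointSum s _ hℰ supp b μ x (bV c) ν y (bV c) (fun X hX => hterm X hX c)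
  simp only [polScalar, abs_mul, abs_inv, Nat.abs_cast]
  by_cases hι : Fintype.card ι = 0
  · rw [hι]; simp [hS0]
  · have hpos : (0 : ℝ) < Fintype.card ι := Nat.cast_pos.2 (Nat.pos_of_ne_zero hι)
    calc (Fintype.card ι : ℝ)⁻¹ * |∑ c, polComp ℝ (expChart (fun U => ∑ X ∈ s, ℰ X U) ρ) bV μ x c ν y c|
        ≤ (Fintype.card ι : ℝ)⁻¹ * ∑ c : ι, S :=
          mul_le_mul_of_nonneg_left ((Finset.abs_sum_le_sum_abs _ _).trans (Finset.sum_le_sum fun c _ => hc c)) (inv_nonneg.2 hpos.le)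
      _ = S := by rw [Finset.sum_const, Finset.card_univ, nsmul_eq_mul, ← mul_assoc, inv_mul_cancel₀ hpos.ne', one_mul]

/-- **★ THE WINDOW SHAPE**: under a TWO-POINT TREE SUM for the weights, `Σ_{X ∈ s, x,y ∈ supp X} a(X) ≤ A·e^{−κ′ d(x,y)}` ([I] (1.18) read through the tree length: every term containing
both sites has `d(X)` at least their distance — `TreeLengthTorus`-type resummation, a hypothesis here), the history difference of the scalar kernel of the localized sum decays:
`|Π(g)(x,y) − Π(g′)(x,y)| ≤ A e^{−κ′ d(x,y)}`. [cite: Balaban1987RG1, (1.18) p.263 and (1.20)-(1.21) p.264] -/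
theorem abs_polScalar_sum_sub_le_of_twoPointSum_le (s : Finset 𝒳) (ℰ ℰ' : 𝒳 → (Λ → T → 𝔄) → ℝ) (ρ : V →L[ℝ] 𝔄) (bV : Module.Basis ι ℝ V)
    (hℰ : ∀ X ∈ s, ContDiffAt ℝ 2 (expChart (ℰ X) ρ) 0) (hℰ' : ∀ X ∈ s, ContDiffAt ℝ 2 (expChart (ℰ' X) ρ) 0)
    (supp : 𝒳 → Set T) [∀ X, DecidablePred (· ∈ supp X)] (a : 𝒳 → ℝ) (ha : ∀ X ∈ s, 0 ≤ a X) (μ : Λ) (x : T) (ν : Λ) (y : T)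
    (hterm : ∀ X ∈ s, ∀ c : ι, |polComp ℝ (expChart (ℰ X) ρ) bV μ x c ν y c - polComp ℝ (expChart (ℰ' X) ρ) bV μ x c ν y c| ≤
      if x ∈ supp X ∧ y ∈ supp X then a X else 0)
    {d : T → T → ℝ} {A κ' : ℝ} (htree : ∑ X ∈ s.filter (fun X => x ∈ supp X ∧ y ∈ supp X), a X ≤ A * Real.exp (-(κ' * d x y))) :
    |polScalar (fun U => ∑ X ∈ s, ℰ X U) ρ bV μ x ν y - polScalar (fun U => ∑ X ∈ s, ℰ' X U) ρ bV μ x ν y| ≤ A * Real.exp (-(κ' * d x y)) :=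
  (abs_polScalar_sum_sub_le_twoPointSum s ℰ ℰ' ρ bV hℰ hℰ' supp a ha μ x ν y hterm).trans htree

/-- **★ THE SAME AT THE WINDOW of the `K`-th torus** — def-B's `polWindow F K j ℰ ρ bV μ ν z` is `polScalar` at the sites `(siteOfInt F K j z, siteOfInt F K j 0)`; so the history
difference of the windowed kernel of a localized sum on the torus `T^{(j)}` of the `K`-th approximation obeys `≤ A e^{−κ′ d(z·, 0·)}` — dag-n22-w3's windowed hypothesis `hK` for THIS `K`
once `A e^{−κ′ d} ≤ e^{−κ|z|₁} Σ_i Λ_i |g_i − g′_i|` is read off (the torus distance of the window sites is `|z|₁` for `K` large; the weights carry `Σ_i Λ_i|Δg_i|`).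
[cite: Balaban1987RG1, (1.18) p.263 and (1.20)-(1.21) p.264] -/
theorem abs_polWindow_sum_sub_le_of_twoPointSum_le (F : T4Continuum.T4Family) (K j : ℕ) (s : Finset 𝒳)
    (ℰ ℰ' : 𝒳 → (Fin (F.P K).d → Site (F.P K) j → 𝔄) → ℝ) (ρ : V →L[ℝ] 𝔄) (bV : Module.Basis ι ℝ V)
    (hℰ : ∀ X ∈ s, ContDiffAt ℝ 2 (expChart (ℰ X) ρ) 0) (hℰ' : ∀ X ∈ s, ContDiffAt ℝ 2 (expChart (ℰ' X) ρ) 0)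
    (supp : 𝒳 → Set (Site (F.P K) j)) [∀ X, DecidablePred (· ∈ supp X)] (a : 𝒳 → ℝ) (ha : ∀ X ∈ s, 0 ≤ a X) (μ ν : Fin 4) (z : Fin 4 → ℤ)
    (hterm : ∀ X ∈ s, ∀ c : ι,
      |polComp ℝ (expChart (ℰ X) ρ) bV (Fin.cast (F.P_d K).symm μ) (siteOfInt F K j z) c (Fin.cast (F.P_d K).symm ν) (siteOfInt F K j 0) c -
        polComp ℝ (expChart (ℰ' X) ρ) bV (Fin.cast (F.P_d K).symm μ) (siteOfInt F K j z) c (Fin.cast (F.P_d K).symm ν) (siteOfInt F K j 0) c| ≤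
      if siteOfInt F K j z ∈ supp X ∧ siteOfInt F K j 0 ∈ supp X then a X else 0)
    {d : Site (F.P K) j → Site (F.P K) j → ℝ} {A κ' : ℝ}
    (htree : ∑ X ∈ s.filter (fun X => siteOfInt F K j z ∈ supp X ∧ siteOfInt F K j 0 ∈ supp X), a X ≤ A * Real.exp (-(κ' * d (siteOfInt F K j z) (siteOfInt F K j 0)))) :
    |polWindow F K j (fun U => ∑ X ∈ s, ℰ X U) ρ bV μ ν z - polWindow F K j (fun U => ∑ X ∈ s, ℰ' X U) ρ bV μ ν z| ≤
      A * Real.exp (-(κ' * d (siteOfInt F K j z) (siteOfInt F K j 0))) :=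
  abs_polScalar_sum_sub_le_of_twoPointSum_le s ℰ ℰ' ρ bV hℰ hℰ' supp a ha _ _ _ _ hterm htree

end Scalar

end YMDAG.N22.WindowOfLocalTerms

end
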